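import Literature.NumberTheory.GaloisRepresentations.InertiaFixesPrimeToResidueRootsProofs
import Mathlib.RingTheory.DedekindDomain.AdicValuation
import HarnessLib

/-!
# The inertia group of a prime `𝔓 ∣ v` of `\bar ℤ_K` fixes the square roots of `v`-units at odd `v`;
# adjoining `√u` (`u` a `v`-unit, more generally of even `v`-order) does not ramify at `v ∤ 2`

`Proofs` file (theorems only), topic `NumberTheory/GaloisRepresentations`; companion of
`InertiaFixesPrimeToResidueRootsProofs.lean` (roots of unity of order prime to `v`), same conventions: a
number field `K`, a finite place `v`, a prime `𝔓` of `\bar ℤ_K = absIntegers (𝓞 K) K` over `v`,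
`σ ∈ I_𝔓 ≤ Γ_K`. The classical fact (Neukirch, *Algebraic Number Theory* II (7.13)–(7.14)/(10.2);
Serre, *Local Fields* IV §2: a Kummer/Eisenstein computation — `K(√u)/K` is unramified at `v ∤ 2u`):

* `Literature.NumberTheory.GaloisRepresentations.smul_eq_of_mem_inertia_of_sq_eq_of_notMem` — **`σ • α = α`
  for `α ∈ K̄` with `α² = u`, `u ∈ 𝓞 K`, `u ∉ v`, `2 ∉ v`** (`σα ≡ α (mod 𝔓)` and `σα = ±α` in the domain
  `\bar ℤ_K`; `σα = −α` would put `(2α)² = 4u` in `𝔓 ∩ 𝓞 K = v`);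
* `…smul_eq_of_mem_inertia_of_sq_eq_of_valuation_eq_one` — the same for a `v`-UNIT `u ∈ K` (`v(u) = 1`;
  `u = n/d` with `n, d ∉ v` by Mathlib's `exists_primeCompl_mul_eq_of_integer`, applied to `α·d`);
* `…smul_eq_of_mem_inertia_of_sq_eq_of_valuation_eq_exp_even` — the same for `c ∈ K` of EVEN `v`-order
  (`v(c) = exp(2k)`: rescale by a uniformizer, `valuation_exists_uniformizer`).

These are the `hS` inputs of `ramificationIdx_adjoin_eq_one_of_forall_smul_eq` (same directory) for square
roots. Consumer (cell abc-iut, reading v3): the field `F‡ = F_tpd(√−1, √λ, √(λ−1), E_λ[3·5])` of the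
theta tower — `√λ`, `√(λ−1)` are unramified at the good odd places of `λ` (`λ`, `λ−1` `v`-units), and at ANY
odd place one of `λ`, `λ−1`, `λ(λ−1)` has even order (abc-iut-S1's (R4) per-place bound). Classical;
nothing here bears on [IUTchIII] Cor. 3.12.

## References

* [NeukirchANT1999] J. Neukirch, *Algebraic Number Theory* (1999), Ch. II (7.13), Ch. V (3.2)/(3.3)
  (`K(√u)/K` unramified at `𝔭 ∤ 2` for a unit `u`).
* [SerreLocalFields1979] J.-P. Serre, *Local Fields*, Ch. IV §2, Ch. I §7 Prop. 22.
-/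

noncomputable section

open scoped Pointwise IntermediateField NumberField

open NumberField IsDedekindDomain IntermediateField Field

universe u

namespace Literature.NumberTheory.GaloisRepresentations

variable {K : Type u} [Field K] [NumberField K]

omit [NumberField K] in
/-- **Inertia fixes the square roots of integral `v`-units at odd `v`**: for `σ ∈ I_𝔓`, `𝔓 ∣ v`, `2 ∉ v`,
`u ∈ 𝓞 K ∖ v` and `α ∈ K̄` with `α² = u`: `σ • α = α`. Proof: `α ∈ \bar ℤ_K`; `σα − α ∈ 𝔓` (inertia) and
`(σα)² = u = α²`, so `σα = α` or `σα = −α` (domain); in the second case `2α ∈ 𝔓`, hence `4u = (2α)² ∈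
𝔓 ∩ 𝓞 K = v`, contradicting `2 ∉ v`, `u ∉ v`. [cite: NeukirchANT1999, Ch. II Prop. (7.13)] -/
theorem smul_eq_of_mem_inertia_of_sq_eq_of_notMem (v : HeightOneSpectrum (𝓞 K))
    {𝔓 : Ideal (absIntegers (𝓞 K) K)} (h𝔓 : 𝔓 ∈ v.primesAbove)
    {σ : absoluteGaloisGroup K} (hσ : σ ∈ 𝔓.inertia (absoluteGaloisGroup K))
    (h2 : (2 : 𝓞 K) ∉ v.asIdeal) {u : 𝓞 K} (hu : u ∉ v.asIdeal)
    {α : AlgebraicClosure K} (hα : α ^ 2 = algebraMap (𝓞 K) (AlgebraicClosure K) u) :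
    σ • α = α := by
  haveI : 𝔓.IsPrime := h𝔓.1
  haveI : 𝔓.LiesOver v.asIdeal := h𝔓.2
  -- `α` is integral over `𝓞 K`
  have hαint : α ∈ absIntegers (𝓞 K) K := by
    rw [absIntegers, mem_integralClosure_iff]
    exact IsIntegral.of_pow two_pos (by rw [hα]; exact isIntegral_algebraMap)
  set z : absIntegers (𝓞 K) K := ⟨α, hαint⟩ with hzdef
  -- the action on `\bar ℤ_K` and on `K̄` agree; `σ` fixes `𝓞 K`
  have hcoe : ((σ • z : absIntegers (𝓞 K) K) : AlgebraicClosure K) = σ • α := by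
    simp [hzdef, integralClosure.coe_smul]
  have hσu : σ • (algebraMap (𝓞 K) (AlgebraicClosure K) u) = algebraMap (𝓞 K) (AlgebraicClosure K) u := by
    rw [IsScalarTower.algebraMap_apply (𝓞 K) K (AlgebraicClosure K), absoluteGaloisGroup.smul_def,
      AlgEquiv.commutes]
  -- `σ • z - z ∈ 𝔓`
  have hσ' := hσ
  rw [Ideal.inertia, AddSubgroup.mem_inertia] at hσ'
  have h1 : σ • z - z ∈ 𝔓 := hσ' z
  -- `(σ • z)^2 = z^2`, hence `(σ z - z)(σ z + z) = 0`
  have hz2 : ((z ^ 2 : absIntegers (𝓞 K) K) : AlgebraicClosure K) =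
      algebraMap (𝓞 K) (AlgebraicClosure K) u := by
    rw [Subalgebra.coe_pow]; exact hα
  have hσz2 : (σ • z) ^ 2 = z ^ 2 := by
    apply Subtype.ext
    rw [Subalgebra.coe_pow, hcoe, hz2, ← smul_pow', hα, hσu]
  have hprod : (σ • z - z) * (σ • z + z) = 0 := by
    have : (σ • z - z) * (σ • z + z) = (σ • z) ^ 2 - z ^ 2 := by ring
    rw [this, hσz2, sub_self]
  rcases mul_eq_zero.mp hprod with h | h
  · -- `σ z = z`
    have := congrArg (fun t : absIntegers (𝓞 K) K => (t : AlgebraicClosure K)) (sub_eq_zero.mp h)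
    simpa [hcoe] using this
  · -- `σ z = -z`: then `2 z ∈ 𝔓`, so `4 u ∈ 𝔓 ∩ 𝓞 K = v` — contradiction
    exfalso
    have hneg : σ • z = -z := eq_neg_of_add_eq_zero_left h
    have h2z : z + z ∈ 𝔓 := by
      have : σ • z - z = -(z + z) := by rw [hneg]; ring
      rw [this] at h1
      exact (Ideal.neg_mem_iff 𝔓).mp h1
    have h4u : algebraMap (𝓞 K) (absIntegers (𝓞 K) K) (2 * 2 * u) ∈ 𝔓 := by
      have hsq : (z + z) * (z + z) ∈ 𝔓 := 𝔓.mul_mem_left _ h2z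
      have hzB : z ^ 2 = algebraMap (𝓞 K) (absIntegers (𝓞 K) K) u :=
        Subtype.ext (by rw [hz2]; rfl)
      have heq : (z + z) * (z + z) = algebraMap (𝓞 K) (absIntegers (𝓞 K) K) (2 * 2 * u) := by
        rw [map_mul, map_mul, ← hzB, map_ofNat]; ring
      rwa [heq] at hsq
    have hv : (2 : 𝓞 K) * 2 * u ∈ v.asIdeal := by
      rw [show v.asIdeal = 𝔓.comap (algebraMap (𝓞 K) (absIntegers (𝓞 K) K)) from Ideal.LiesOver.over,
        Ideal.mem_comap]
      exact h4u
    haveI := v.isPrime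
    rcases Ideal.IsPrime.mem_or_mem inferInstance hv with h' | h'
    · rcases Ideal.IsPrime.mem_or_mem inferInstance h' with h'' | h'' <;> exact h2 h''
    · exact hu h'

/-- **Inertia fixes the square roots of `v`-units of `K` at odd `v`**: `u ∈ K` with `v(u) = 1`, `2 ∉ v`,
`α² = u` ⇒ `σ • α = α` for `σ ∈ I_𝔓` (write `u·d = n` with `n, d ∈ 𝓞 K ∖ v` — Mathlib
`exists_primeCompl_mul_eq_of_integer` — and apply the integral case to `α·d`, `(α d)² = n d`).
[cite: NeukirchANT1999, Ch. II Prop. (7.13)] -/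
theorem smul_eq_of_mem_inertia_of_sq_eq_of_valuation_eq_one (v : HeightOneSpectrum (𝓞 K))
    {𝔓 : Ideal (absIntegers (𝓞 K) K)} (h𝔓 : 𝔓 ∈ v.primesAbove)
    {σ : absoluteGaloisGroup K} (hσ : σ ∈ 𝔓.inertia (absoluteGaloisGroup K))
    (h2 : (2 : 𝓞 K) ∉ v.asIdeal) {u : K} (hu : v.valuation K u = 1)
    {α : AlgebraicClosure K} (hα : α ^ 2 = algebraMap K (AlgebraicClosure K) u) :
    σ • α = α := by
  obtain ⟨n, d, hnd⟩ := v.exists_primeCompl_mul_eq_of_integer u hu.le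
  have hd : (d : 𝓞 K) ∉ v.asIdeal := d.2
  -- `n ∉ v`: `v(n) = v(u)·v(d) = 1`
  have hn : n ∉ v.asIdeal := by
    intro hn
    have h1 : v.valuation K (algebraMap (𝓞 K) K n) < 1 := by
      rw [HeightOneSpectrum.valuation_of_algebraMap]; exact (v.intValuation_lt_one_iff_mem n).mpr hn
    have h2 : v.valuation K (algebraMap (𝓞 K) K n) = 1 := by
      rw [← hnd, map_mul, hu, one_mul, HeightOneSpectrum.valuation_of_algebraMap]
      exact (v.intValuation_eq_one_iff_mem_primeCompl d).mpr d.2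
    rw [h2] at h1
    exact lt_irrefl _ h1
  have hnd' : n * (d : 𝓞 K) ∉ v.asIdeal := by
    haveI := v.isPrime
    intro h
    rcases Ideal.IsPrime.mem_or_mem inferInstance h with h' | h'
    · exact hn h'
    · exact hd h'
  -- apply the integral case to `β = α·d`
  set β : AlgebraicClosure K := α * algebraMap (𝓞 K) (AlgebraicClosure K) d with hβ
  have hβ2 : β ^ 2 = algebraMap (𝓞 K) (AlgebraicClosure K) (n * d) := by
    rw [hβ, mul_pow, hα, map_mul, IsScalarTower.algebraMap_apply (𝓞 K) K (AlgebraicClosure K) n,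
      IsScalarTower.algebraMap_apply (𝓞 K) K (AlgebraicClosure K) (d : 𝓞 K), ← map_pow, ← map_mul,
      ← map_mul, ← hnd]
    congr 1
    ring
  have hfix := smul_eq_of_mem_inertia_of_sq_eq_of_notMem v h𝔓 hσ h2 hnd' hβ2
  have hσd : σ • (algebraMap (𝓞 K) (AlgebraicClosure K) d) = algebraMap (𝓞 K) (AlgebraicClosure K) d := by
    rw [IsScalarTower.algebraMap_apply (𝓞 K) K (AlgebraicClosure K), absoluteGaloisGroup.smul_def,
      AlgEquiv.commutes]
  have hd0 : algebraMap (𝓞 K) (AlgebraicClosure K) (d : 𝓞 K) ≠ 0 := by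
    rw [IsScalarTower.algebraMap_apply (𝓞 K) K (AlgebraicClosure K), map_ne_zero_iff _ (algebraMap K _).injective,
      map_ne_zero_iff _ (FaithfulSMul.algebraMap_injective (𝓞 K) K)]
    intro h0
    exact hd (h0 ▸ v.asIdeal.zero_mem)
  rw [hβ, smul_mul', hσd] at hfix
  exact mul_right_cancel₀ hd0 hfix

/-- **Inertia fixes the square roots of elements of even `v`-order at odd `v`**: `c ∈ K` with `v(c) =
exp(2k)`, `2 ∉ v`, `α² = c` ⇒ `σ • α = α` for `σ ∈ I_𝔓` (rescale by a uniformizer `π`: `c·π^{2k}` is a `v`-unit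
with square root `α·π^k`). [cite: NeukirchANT1999, Ch. II Prop. (7.13)] -/
theorem smul_eq_of_mem_inertia_of_sq_eq_of_valuation_eq_exp_even (v : HeightOneSpectrum (𝓞 K))
    {𝔓 : Ideal (absIntegers (𝓞 K) K)} (h𝔓 : 𝔓 ∈ v.primesAbove)
    {σ : absoluteGaloisGroup K} (hσ : σ ∈ 𝔓.inertia (absoluteGaloisGroup K))
    (h2 : (2 : 𝓞 K) ∉ v.asIdeal) {c : K} {k : ℤ} (hc : v.valuation K c = WithZero.exp (2 * k))
    {α : AlgebraicClosure K} (hα : α ^ 2 = algebraMap K (AlgebraicClosure K) c) :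
    σ • α = α := by
  obtain ⟨π, hπ⟩ := v.valuation_exists_uniformizer K
  have hπ0 : π ≠ 0 := by
    intro h; rw [h, map_zero] at hπ; exact WithZero.exp_ne_zero hπ.symm
  -- the `v`-unit `u = c·π^{2k}`
  set u : K := c * π ^ (2 * k) with hudef
  have hu : v.valuation K u = 1 := by
    rw [hudef, map_mul, map_zpow₀, hc, hπ, ← WithZero.exp_zsmul, ← WithZero.exp_add]
    convert WithZero.exp_zero using 2
    simp only [smul_eq_mul]; ring
  set β : AlgebraicClosure K := α * (algebraMap K (AlgebraicClosure K) π) ^ k with hβ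
  have hβ2 : β ^ 2 = algebraMap K (AlgebraicClosure K) u := by
    rw [hβ, mul_pow, hα, hudef, map_mul, map_zpow₀, ← zpow_natCast, ← zpow_mul]
    congr 2
    push_cast; ring
  have hfix := smul_eq_of_mem_inertia_of_sq_eq_of_valuation_eq_one v h𝔓 hσ h2 hu hβ2
  have hσπ : σ • ((algebraMap K (AlgebraicClosure K) π) ^ k) = (algebraMap K (AlgebraicClosure K) π) ^ k := by
    rw [absoluteGaloisGroup.smul_def, map_zpow₀, AlgEquiv.commutes]
  have hπk : (algebraMap K (AlgebraicClosure K) π) ^ k ≠ 0 :=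
    zpow_ne_zero k ((map_ne_zero_iff _ (algebraMap K _).injective).mpr hπ0)
  rw [hβ, smul_mul', hσπ] at hfix
  exact mul_right_cancel₀ hπk hfix

/-- **At every finite place one of `x`, `x − 1`, `x(x − 1)` has EVEN order** (`x ≠ 0`): if `v(x) = 1` take
`x`; if `v(x) < 1` then `x − 1` is a `v`-unit; if `v(x) > 1` then `v(x − 1) = v(x)` and `x(x−1)` has order
`2·ord(x)`. With the preceding lemmas: at every ODD place some square root among `√x, √(x−1), √(x(x−1))` is fixed
by inertia — for the Legendre parameter `x = λ` this is the even-order twist root used in the cell's (R4)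
per-place bound for `F‡ = F_tpd(√−1, √λ, √(λ−1), E_λ[15])` (abc-iut-S1). [cite: NeukirchANT1999, Ch. II Prop. (7.13)] -/
theorem exists_valuation_eq_exp_two_mul (v : HeightOneSpectrum (𝓞 K)) {x : K} (hx : x ≠ 0) :
    ∃ c ∈ ({x, x - 1, x * (x - 1)} : Set K), ∃ k : ℤ, v.valuation K c = WithZero.exp (2 * k) := by
  rcases lt_trichotomy (v.valuation K x) 1 with h | h | h
  · -- `x ∈ 𝔪_v`: `x - 1` is a unit
    refine ⟨x - 1, by simp, 0, ?_⟩
    rw [show x - 1 = -(1 - x) by ring, Valuation.map_neg, Valuation.map_one_sub_of_lt _ h]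
    simp
  · exact ⟨x, by simp, 0, by simpa using h⟩
  · -- `ord_v x < 0`: `v(x - 1) = v(x)`, so `x(x-1)` has even order
    have hx1 : v.valuation K (x - 1) = v.valuation K x :=
      Valuation.map_sub_eq_of_lt_left _ (by rw [Valuation.map_one]; exact h)
    have hne : v.valuation K x ≠ 0 := by rwa [ne_eq, map_eq_zero]
    refine ⟨x * (x - 1), by simp, WithZero.log (v.valuation K x), ?_⟩
    rw [map_mul, hx1, two_mul, WithZero.exp_add, WithZero.exp_log hne]

end Literature.NumberTheory.GaloisRepresentations
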